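import Summits.BirchSwinnertonDyer.BirchSwinnertonDyer.Theorems.ByReductionTypeAtTwoMultTowerNS2LocalLayerField
import Literature.NumberTheory.GaloisRepresentations.LocalEulerCharacteristicMu
import Literature.NumberTheory.GaloisRepresentations.LocalCorInjective
import Literature.NumberTheory.GaloisRepresentations.CyclicIndexEulerChar
import Literature.NumberTheory.GaloisRepresentations.ContinuousCohomologyTransport
import Literature.NumberTheory.GaloisRepresentations.KummerTwo
import Literature.NumberTheory.GaloisRepresentations.LocalGlobalCohomologyFiniteProofs
import Literature.NumberTheory.GaloisRepresentations.LocalFieldCdTwo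
import Literature.NumberTheory.GaloisRepresentations.KummerIdeleIndex
import Literature.NumberTheory.EllipticCurves.OrdinaryLocalReductionMapProofs
import HarnessLib

/-!
# Route `ByReductionTypeAtTwo`, item `OrdKatoHalfAtTwo` (stmt-BirchSwinnertonDyer-19271), TOWER road, the
# GOOD-ORDINARY local constant at `v ∣ 2`: KERNEL BRICK G5 — the local Euler–Poincaré count up the cyclotomic
# `ℤ₂`-tower: `#H¹(H_n, μ₂) = 2^{2^n + 2}` and `#Hom_cont(H_n, ℤ/2) ≤ 2^{2^n + 2}`

HONEST FRAMING (cell `bsd-2adic`, run/shared/lean/pub/bsd-2adic/, seat `bsd-2adic-tower-1` GEN 11, HUMAN RULINGS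
D-0036 / D-0054 / D-0074): TOOL theorems only (no definition, no named fact, no `sorry`); closes nothing by itself;
nothing booked; BSD is not proved by any of this. Step S4 of the KERNELISATION of the consumed projection
`#𝒦_{v,n}[2^∞][2] ≤ 4` of the PRINT binder `hS34 = Greenberg1999.lemma34_localTowerKerPrimary_cyclicExtension_rat`
(scope memo HOME/tower/SCOPE-hS34-layer-kernel-at-2-GEN7.md §3 (M1)+(M2)): the right-hand side of BRICK G3's Kummer count.
Setting: `κ` the cyclotomic `ℤ₂`-extension of `ℚ`, `v ∋ 2`, `F = ℚ_v`, `H_k = localSubgroup (κ.layerSubgroup k) F` (open of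
index `2^k`, GEN 8), `μ₂` the Galois module of square roots of unity of `F̄` (trivial action: `−1 ∈ F`).

* `natCard_cohomology_mu_two_layer` — **`#H¹(H_n, μ₂) = 2^{2^n+2}` and `#H²(H_n, μ₂) = 2`** (with finiteness), by induction
  on `n`: the base is Tate's local Euler–Poincaré characteristic over `ℚ₂` (`localEulerPoincareCharacteristic_mu_adicCompletion`:
  `#H¹(ℚ₂, μ₂) = #μ₂ · #H² · #(ℤ₂/2) = 8`), the step is the tree's multiplicativity in a cyclic step of degree `2`
  (`CyclicIndexEulerChar.card_euler_cyclic_step`, Serre II §5.7 Lemme 7) along `H_{k+1} ⊴ H_k`, transported from the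
  subgroup-of-a-subgroup `H_{k+1} ∩ H_k ≤ H_k` to `H_{k+1} ≤ Γ_F` (`ContinuousCohomologyTransport`), with `#H²(H_k, μ₂) = 2`
  at every level (`natCard_two_mu_eq`, `|Br(L)[2]| = 2`);
* **`natCard_contHom_zmod_two_layer_le`** — the continuous homomorphisms `H_n → ℤ/2` are finitely many, at most
  `2^{2^n+2}` (they inject into `H¹(H_n, μ₂)`: trivial action, no coboundaries).

References: J.-P. Serre, *Galois Cohomology* (1997), II §5.7 (Thm. 5, Lemme 7), II §5.2; J. Milne, *ADT* (2006), I Thm. 2.8;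
L. Washington, *Cyclotomic Fields*, §13.1; scope memo §3 (M1), (M2).
-/

set_option autoImplicit false
-- the Theorems namespace of this sub repeats the summit name by design (D-0017 nested layout: Summit.<S>.<Sub>)
set_option linter.dupNamespace false

noncomputable section

open scoped Classical

namespace Summit.BirchSwinnertonDyer.BirchSwinnertonDyer.Theorems.GoodOrdTower

open CategoryTheory NumberField IsDedekindDomain Field
  Literature.NumberTheory.GaloisRepresentations Literature.NumberTheory.GaloisRepresentations.DiscreteGaloisModule
  IntermediateField _root_.TopRep _root_.ContRepresentation _root_.ContinuousCohomology
open Literature.NumberTheory.EllipticCurves hiding subgroupIncl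
open Valued

variable {κ : ZpExtension ℚ 2}

/-- A closed subgroup of a compact group is compact (instance form for subgroup types). [folklore] -/
private theorem compactSpace_subgroup {G : Type*} [Group G] [TopologicalSpace G] [CompactSpace G]
    (S : Subgroup G) (hS : IsClosed (S : Set G)) : CompactSpace S :=
  isCompact_iff_compactSpace.mp hS.isCompact

/-- `𝒪[ℚ_v]` (valuation ring of the `ValuativeRel` structure) has the same elements as the ring of `v`-adic integers
(copy of the private helper of `LocalEulerCharacteristicMu`). [folklore] -/
private theorem valuativeRel_integer_eq_valued_integer' (v : HeightOneSpectrum (𝓞 ℚ)) :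
    (ValuativeRel.valuation (v.adicCompletion ℚ)).integer = Valued.integer (v.adicCompletion ℚ) := by
  ext x
  rw [Valuation.mem_integer_iff, adicCompletion_valuation_le_one_iff ℚ v x,
    Valuation.mem_integer_iff, Valued.toNormedField.norm_le_one_iff]

/-- `#(𝒪[ℚ_v] ⧸ m) = #(ℤ_v ⧸ m)` for `m : ℕ`, the two valuation rings having the same elements (copy of the private helper
of `LocalEulerCharacteristicMu`). [folklore] -/
private theorem natCard_integer_quotient_natCast_eq' (v : HeightOneSpectrum (𝓞 ℚ)) (m : ℕ) :
    Nat.card ((ValuativeRel.valuation (v.adicCompletion ℚ)).integer ⧸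
        Ideal.span {((m : ℕ) : (ValuativeRel.valuation (v.adicCompletion ℚ)).integer)}) =
      Nat.card (Valued.integer (v.adicCompletion ℚ) ⧸
        Ideal.span {((m : ℕ) : Valued.integer (v.adicCompletion ℚ))}) := by
  have hO := valuativeRel_integer_eq_valued_integer' v
  let e : (ValuativeRel.valuation (v.adicCompletion ℚ)).integer ≃+* Valued.integer (v.adicCompletion ℚ) :=
    RingEquiv.subringCongr hO
  have hIJ : Ideal.span {((m : ℕ) : Valued.integer (v.adicCompletion ℚ))} =
      (Ideal.span {((m : ℕ) : (ValuativeRel.valuation (v.adicCompletion ℚ)).integer)}).map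
        (e : (ValuativeRel.valuation (v.adicCompletion ℚ)).integer →+* _) := by
    rw [Ideal.map_span, Set.image_singleton, map_natCast]
  exact Nat.card_congr (Ideal.quotientEquiv _ _ e hIJ).toEquiv

/-- **Transport `Hq(T ∩ S ≤ S, M) = Hq(T ≤ G, M)`**: for subgroups `T ≤ S` of a topological group `G` and a continuous
`G`-module `M`, the continuous cohomology of the subgroup-of-a-subgroup `T.subgroupOf S` (coefficients `(M|_S)|_{T ∩ S}`) and
of `T` (coefficients `M|_T`) have the same cardinality, and the former is finite if the latter is — the isomorphism of
pairs `(T.subgroupOf S, (M|_S)|) ≅ (T, M|_T)` (`Subgroup.subgroupOfEquivOfLe`, identity on `M`) and the tree's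
`ContinuousCohomologyTransport`. [cite: SerreGaloisCohomology1997, I §2.4] -/
theorem natCard_continuousCohomology_subgroupOf_eq {G : Type} [Group G] [TopologicalSpace G] [IsTopologicalGroup G]
    {M : Type} [AddCommGroup M] [TopologicalSpace M] [DiscreteTopology M] (ρ : ContinuousRep G ℤ M)
    {T S : Subgroup G} (h : T ≤ S) (q : ℕ) :
    Nat.card (continuousCohomology q
        (((ρ.restrict (subgroupIncl S)).restrict (subgroupIncl (T.subgroupOf S))).toTopRep)) =
      Nat.card (continuousCohomology q ((ρ.restrict (subgroupIncl T)).toTopRep)) ∧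
    (Finite (continuousCohomology q ((ρ.restrict (subgroupIncl T)).toTopRep)) →
      Finite (continuousCohomology q
        (((ρ.restrict (subgroupIncl S)).restrict (subgroupIncl (T.subgroupOf S))).toTopRep))) := by
  let eS : T.subgroupOf S ≃* T := Subgroup.subgroupOfEquivOfLe h
  have hc1 : Continuous eS := (continuous_subtype_val.comp continuous_subtype_val).subtype_mk _
  have hc2 : Continuous eS.symm := (continuous_subtype_val.subtype_mk _).subtype_mk _
  let e : T.subgroupOf S ≃ₜ* T := { eS with continuous_toFun := hc1, continuous_invFun := hc2 }
  let X : TopRep ℤ (T.subgroupOf S) := ((ρ.restrict (subgroupIncl S)).restrict (subgroupIncl (T.subgroupOf S))).toTopRep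
  let Y : TopRep ℤ T := (ρ.restrict (subgroupIncl T)).toTopRep
  let φ : TopRep.res ((e.symm : T →ₜ* T.subgroupOf S) : T →* T.subgroupOf S) X ⟶ Y :=
    TopRep.ofHom ⟨ContinuousLinearMap.id ℤ M, fun _ ↦ rfl⟩
  let ψ : TopRep.res ((e : T.subgroupOf S →ₜ* T) : T.subgroupOf S →* T) Y ⟶ X :=
    TopRep.ofHom ⟨ContinuousLinearMap.id ℤ M, fun _ ↦ rfl⟩
  have hψφ : ∀ x : X, ψ.hom (φ.hom x) = x := fun _ ↦ rfl
  have hφψ : ∀ y : Y, φ.hom (ψ.hom y) = y := fun _ ↦ rfl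
  exact ⟨natCard_continuousCohomology_eq_of_continuousMulEquiv e φ ψ hψφ hφψ q,
    fun _ ↦ finite_continuousCohomology_of_continuousMulEquiv e φ ψ hψφ q⟩

/-- **`#H¹(H_n, μ₂) = 2^{2^n+2}`, `#H²(H_n, μ₂) = 2`** (both finite) for the local layer subgroups `H_n ≤ Γ_{ℚ_v}` of the
cyclotomic `ℤ₂`-tower at `v ∣ 2` and the Galois module `μ₂` restricted to `H_n`: local Euler–Poincaré characteristic over
`ℚ₂` and `n` cyclic steps of degree `2`. [cite: SerreGaloisCohomology1997, II §5.7 Thm. 5 and Lemme 7]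
[cite: MilneADT2006, I §2 Thm. 2.8] -/
theorem natCard_cohomology_mu_two_layer (hκ : κ.IsCyclotomic) (v : HeightOneSpectrum (𝓞 ℚ))
    (hv : ((2 : ℕ) : 𝓞 ℚ) ∈ v.asIdeal) (n : ℕ) :
    Finite (continuousCohomology 1 ((mu (v.adicCompletion ℚ) 2).restrict
        (subgroupIncl (localSubgroup (κ.layerSubgroup n) (v.adicCompletion ℚ)))).toTopRep) ∧
      Finite (continuousCohomology 2 ((mu (v.adicCompletion ℚ) 2).restrict
        (subgroupIncl (localSubgroup (κ.layerSubgroup n) (v.adicCompletion ℚ)))).toTopRep) ∧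
      Nat.card (continuousCohomology 1 ((mu (v.adicCompletion ℚ) 2).restrict
        (subgroupIncl (localSubgroup (κ.layerSubgroup n) (v.adicCompletion ℚ)))).toTopRep) = 2 ^ (2 ^ n + 2) ∧
      Nat.card (continuousCohomology 2 ((mu (v.adicCompletion ℚ) 2).restrict
        (subgroupIncl (localSubgroup (κ.layerSubgroup n) (v.adicCompletion ℚ)))).toTopRep) = 2 := by
  -- notation
  haveI : Fact (Nat.Prime 2) := ⟨Nat.prime_two⟩
  haveI hΓc : CompactSpace (absoluteGaloisGroup (v.adicCompletion ℚ)) := absoluteGaloisGroup_compactSpace (v.adicCompletion ℚ)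
  -- `μ₂` : two elements, trivial action, killed by `2`
  have hμcard : Nat.card (MuCarrier (v.adicCompletion ℚ) 2) = 2 := by
    haveI : CharZero (v.adicCompletion ℚ) :=
      charZero_of_injective_algebraMap (algebraMap ℚ (v.adicCompletion ℚ)).injective
    haveI : CharZero (AlgebraicClosure (v.adicCompletion ℚ)) :=
      charZero_of_injective_algebraMap (algebraMap (v.adicCompletion ℚ) _).injective
    haveI : NeZero ((2 : ℕ) : AlgebraicClosure (v.adicCompletion ℚ)) := ⟨Nat.cast_ne_zero.mpr two_ne_zero⟩
    change Nat.card (rootsOfUnity 2 (AlgebraicClosure (v.adicCompletion ℚ))) = 2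
    exact HasEnoughRootsOfUnity.natCard_rootsOfUnity _ 2
  haveI : Finite (MuCarrier (v.adicCompletion ℚ) 2) := Nat.finite_of_card_ne_zero (by rw [hμcard]; exact two_ne_zero)
  have hμ2 : ∀ m : MuCarrier (v.adicCompletion ℚ) 2, 2 • m = 0 := fun m ↦ by
    have h := card_nsmul_eq_zero' (x := m)
    rwa [hμcard] at h
  -- (`CharZero` only inside this block: a local `CharZero` instance would switch `Algebra ℚ ℚ_v` to
  -- `DivisionRing.toRatAlgebra` in later elaborations)
  have hζ : IsPrimitiveRoot (-1 : (v.adicCompletion ℚ)) 2 := by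
    haveI : CharZero (v.adicCompletion ℚ) :=
      charZero_of_injective_algebraMap (algebraMap ℚ (v.adicCompletion ℚ)).injective
    exact IsPrimitiveRoot.neg_one 0 (by norm_num)
  have htriv : ∀ (σ : (absoluteGaloisGroup (v.adicCompletion ℚ))) (z : MuCarrier (v.adicCompletion ℚ) 2), mu (v.adicCompletion ℚ) 2 σ z = z := mu_apply_eq_self_of_isPrimitiveRoot (v.adicCompletion ℚ) hζ
  -- invariants of every restriction: all of `μ₂`
  have hinv : ∀ k : ℕ, Nat.card (((mu (v.adicCompletion ℚ) 2).restrict (subgroupIncl (localSubgroup (κ.layerSubgroup k) (v.adicCompletion ℚ))))).toTopRep.ρ.invariants = 2 := fun k ↦ by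
    refine (Nat.card_congr ?_).trans hμcard
    exact { toFun := fun w ↦ w.1
            invFun := fun m ↦ ⟨m, fun σ ↦ htriv _ m⟩
            left_inv := fun _ ↦ rfl
            right_inv := fun _ ↦ rfl }
  -- openness, closedness of the layers
  have hopen : ∀ k : ℕ, IsOpen ((localSubgroup (κ.layerSubgroup k) (v.adicCompletion ℚ)) : Set (absoluteGaloisGroup (v.adicCompletion ℚ))) := fun k ↦
    MultTowerNS2.isOpen_localSubgroup _ (κ.isOpen_layerSubgroup k) (v.adicCompletion ℚ)
  have hclosed : ∀ k : ℕ, IsClosed ((localSubgroup (κ.layerSubgroup k) (v.adicCompletion ℚ)) : Set (absoluteGaloisGroup (v.adicCompletion ℚ))) := fun k ↦ Subgroup.isClosed_of_isOpen _ (hopen k)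
  -- `#H²(H_k, μ₂) = 2` at every level
  have hH2 : ∀ k : ℕ, Nat.card (continuousCohomology 2 (((mu (v.adicCompletion ℚ) 2).restrict (subgroupIncl (localSubgroup (κ.layerSubgroup k) (v.adicCompletion ℚ))))).toTopRep) = 2 := fun k ↦ by
    obtain ⟨E, hEfin, hE⟩ := exists_galFixing_eq_of_isOpen ((localSubgroup (κ.layerSubgroup k) (v.adicCompletion ℚ))) (hopen k)
    haveI := hEfin
    change Nat.card (continuousCohomology 2 ((mu (v.adicCompletion ℚ) 2).restrict (subgroupIncl ((localSubgroup (κ.layerSubgroup k) (v.adicCompletion ℚ))))).toTopRep) = 2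
    rw [← hE]
    -- (`CharZero` as late as possible, see `hζ` below)
    haveI : CharZero (v.adicCompletion ℚ) :=
      charZero_of_injective_algebraMap (algebraMap ℚ (v.adicCompletion ℚ)).injective
    exact natCard_two_mu_eq (v.adicCompletion ℚ) E 2
  -- the induction
  suffices hmain : ∀ k : ℕ, Finite (continuousCohomology 1 (((mu (v.adicCompletion ℚ) 2).restrict (subgroupIncl (localSubgroup (κ.layerSubgroup k) (v.adicCompletion ℚ))))).toTopRep) ∧
      Finite (continuousCohomology 2 (((mu (v.adicCompletion ℚ) 2).restrict (subgroupIncl (localSubgroup (κ.layerSubgroup k) (v.adicCompletion ℚ))))).toTopRep) ∧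
      Nat.card (continuousCohomology 1 (((mu (v.adicCompletion ℚ) 2).restrict (subgroupIncl (localSubgroup (κ.layerSubgroup k) (v.adicCompletion ℚ))))).toTopRep) = 2 ^ (2 ^ k + 2) from
    ⟨(hmain n).1, (hmain n).2.1, (hmain n).2.2, hH2 n⟩
  intro k
  induction k with
  | zero =>
    -- `H_0` is everything: transport from `Γ_F`
    have hmem0 : ∀ σ : (absoluteGaloisGroup (v.adicCompletion ℚ)), σ ∈ (localSubgroup (κ.layerSubgroup 0) (v.adicCompletion ℚ)) := fun σ ↦ by
      rw [mem_localSubgroup_iff, ZpExtension.layerSubgroup_zero]; exact Subgroup.mem_top _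
    obtain ⟨hfin1, hfin2, hEP⟩ := localEulerPoincareCharacteristic_mu_adicCompletion ℚ v 2
    have e1 := resHEquivOfTop (mu (v.adicCompletion ℚ) 2) ((localSubgroup (κ.layerSubgroup 0) (v.adicCompletion ℚ))) hmem0 1
    have e2 := resHEquivOfTop (mu (v.adicCompletion ℚ) 2) ((localSubgroup (κ.layerSubgroup 0) (v.adicCompletion ℚ))) hmem0 2
    haveI : Finite (continuousCohomology 1 (((mu (v.adicCompletion ℚ) 2).restrict (subgroupIncl (localSubgroup (κ.layerSubgroup 0) (v.adicCompletion ℚ))))).toTopRep) := Finite.of_equiv _ e1.toEquiv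
    haveI : Finite (continuousCohomology 2 (((mu (v.adicCompletion ℚ) 2).restrict (subgroupIncl (localSubgroup (κ.layerSubgroup 0) (v.adicCompletion ℚ))))).toTopRep) := Finite.of_equiv _ e2.toEquiv
    refine ⟨inferInstance, inferInstance, ?_⟩
    -- `#H¹(ℚ_v, μ₂) = #μ₂ · #H² · #(𝒪/2) = 2 · 2 · 2`
    have hinvΓ : Nat.card (mu (v.adicCompletion ℚ) 2).toTopRep.ρ.invariants = 2 := by
      refine (Nat.card_congr ?_).trans hμcard
      exact { toFun := fun w ↦ w.1
              invFun := fun m ↦ ⟨m, fun σ ↦ htriv σ m⟩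
              left_inv := fun _ ↦ rfl
              right_inv := fun _ ↦ rfl }
    have hH2Γ : Nat.card (continuousCohomology 2 (mu (v.adicCompletion ℚ) 2).toTopRep) = 2 := by
      rw [Nat.card_congr e2.toEquiv]; exact hH2 0
    -- `#(𝒪_v / 2) = 2`: `v` is the only place of `ℚ` above `2` and `∏_{v ∣ 2} #(𝒪_v/2) = 2^{[ℚ:ℚ]}`
    have hO : Nat.card ((ValuativeRel.valuation (v.adicCompletion ℚ)).integer ⧸
        Ideal.span {((Nat.card (MuCarrier (v.adicCompletion ℚ) 2) : ℕ) :
          (ValuativeRel.valuation (v.adicCompletion ℚ)).integer)}) = 2 := by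
      rw [hμcard, natCard_integer_quotient_natCast_eq' v 2]
      have hT : ∀ v' : HeightOneSpectrum (𝓞 ℚ), ((2 : ℕ) : 𝓞 ℚ) ∈ v'.asIdeal → v' ∈ ({v} : Finset _) := by
        intro v' hv'
        rw [Finset.mem_singleton]
        apply (Rat.HeightOneSpectrum.primesEquiv (R := 𝓞 ℚ)).injective
        exact Subtype.ext ((Rat.HeightOneSpectrum.primesEquiv_eq_of_natCast_mem v' Nat.prime_two hv').trans
          (Rat.HeightOneSpectrum.primesEquiv_eq_of_natCast_mem v Nat.prime_two hv).symm)
      have h := prod_natCard_integer_quotient_natCast (K := ℚ) two_ne_zero hT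
      rw [Finset.prod_singleton, Module.finrank_self, pow_one] at h
      exact h
    rw [hinvΓ, hH2Γ, hO] at hEP
    rw [← Nat.card_congr e1.toEquiv, ← hEP]
    norm_num
  | succ k ih =>
    obtain ⟨hfin1, hfin2, hcard1⟩ := ih
    haveI := hfin1
    haveI := hfin2
    haveI : CompactSpace ((localSubgroup (κ.layerSubgroup k) (v.adicCompletion ℚ))) := compactSpace_subgroup ((localSubgroup (κ.layerSubgroup k) (v.adicCompletion ℚ))) (hclosed k)
    -- the cyclic step `S = H_{k+1} ∩ H_k ⊴ H_k` of index `2`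
    have hle : (localSubgroup (κ.layerSubgroup (k + 1)) (v.adicCompletion ℚ)) ≤ (localSubgroup (κ.layerSubgroup k) (v.adicCompletion ℚ)) := MultTowerNS2.localSubgroup_layerSubgroup_succ_le (κ := κ) v k
    let S : Subgroup ((localSubgroup (κ.layerSubgroup k) (v.adicCompletion ℚ))) := ((localSubgroup (κ.layerSubgroup (k + 1)) (v.adicCompletion ℚ))).subgroupOf ((localSubgroup (κ.layerSubgroup k) (v.adicCompletion ℚ)))
    haveI hSn : S.Normal := by
      have : ((localSubgroup (κ.layerSubgroup (k + 1)) (v.adicCompletion ℚ))).Normal := by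
        rw [localSubgroup_eq_comap]; exact Subgroup.Normal.comap inferInstance _
      exact Subgroup.normal_subgroupOf
    have hidx : S.index = 2 := by
      change ((localSubgroup (κ.layerSubgroup (k + 1)) (v.adicCompletion ℚ))).relIndex ((localSubgroup (κ.layerSubgroup k) (v.adicCompletion ℚ))) = 2
      exact MultTowerNS2.relIndex_localSubgroup_layerSubgroup_succ hκ v hv k
    have hSopen : IsOpen (S : Set ((localSubgroup (κ.layerSubgroup k) (v.adicCompletion ℚ)))) := (hopen (k + 1)).preimage continuous_subtype_val
    have hStop : S ≠ ⊤ := fun h ↦ by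
      rw [h, Subgroup.index_top] at hidx
      exact absurd hidx (by norm_num)
    obtain ⟨γ, -, hγ⟩ := SetLike.exists_of_lt (lt_top_iff_ne_top.mpr hStop)
    have h3 : ∀ {V : Type} [AddCommGroup V] [TopologicalSpace V] [DiscreteTopology V]
        (τ : ContinuousRep ((localSubgroup (κ.layerSubgroup k) (v.adicCompletion ℚ))) ℤ V), (∀ x : V, 2 • x = 0) → Subsingleton (continuousCohomology 3 τ.toTopRep) := by
      intro V _ _ _ τ hV
      haveI : CharZero (v.adicCompletion ℚ) :=
        charZero_of_injective_algebraMap (algebraMap ℚ (v.adicCompletion ℚ)).injective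
      exact groupCdLE_two_of_isClosed (v.adicCompletion ℚ) _ (hclosed k) 2 V τ (fun x ↦ ⟨1, by rw [pow_one]; exact hV x⟩)
        (by norm_num)
    have hstep := card_euler_cyclic_step (S := S) (ρ := ((mu (v.adicCompletion ℚ) 2).restrict (subgroupIncl (localSubgroup (κ.layerSubgroup k) (v.adicCompletion ℚ))))) Nat.prime_two hidx hγ hSopen hμ2 h3
    have hfinS1 := finite_continuousCohomology_restrict_one (S := S) (ρ := ((mu (v.adicCompletion ℚ) 2).restrict (subgroupIncl (localSubgroup (κ.layerSubgroup k) (v.adicCompletion ℚ))))) Nat.prime_two hidx hγ hSopen hμ2 h3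
    have hfinS2 := finite_continuousCohomology_restrict_two (S := S) (ρ := ((mu (v.adicCompletion ℚ) 2).restrict (subgroupIncl (localSubgroup (κ.layerSubgroup k) (v.adicCompletion ℚ))))) Nat.prime_two hidx hγ hSopen hμ2 h3
    -- transport from `S ≤ H_k` to `H_{k+1} ≤ Γ`
    obtain ⟨htr1, hfinT1⟩ := natCard_continuousCohomology_subgroupOf_eq (mu (v.adicCompletion ℚ) 2) hle 1
    obtain ⟨htr2, hfinT2⟩ := natCard_continuousCohomology_subgroupOf_eq (mu (v.adicCompletion ℚ) 2) hle 2
    haveI := hfinS1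
    haveI := hfinS2
    haveI hfin1' : Finite (continuousCohomology 1 ((mu (v.adicCompletion ℚ) 2).restrict (subgroupIncl (localSubgroup (κ.layerSubgroup (k + 1)) (v.adicCompletion ℚ)))).toTopRep) :=
      Nat.finite_of_card_ne_zero (by rw [← htr1]; exact Nat.card_pos.ne')
    haveI hfin2' : Finite (continuousCohomology 2 ((mu (v.adicCompletion ℚ) 2).restrict (subgroupIncl (localSubgroup (κ.layerSubgroup (k + 1)) (v.adicCompletion ℚ)))).toTopRep) :=
      Nat.finite_of_card_ne_zero (by rw [← htr2]; exact Nat.card_pos.ne')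
    refine ⟨hfin1', hfin2', ?_⟩
    -- the count: `2 · 2 · x_k² = h¹(S) · (2 · 2)²`
    have hinvS : Nat.card ((((mu (v.adicCompletion ℚ) 2).restrict (subgroupIncl (localSubgroup (κ.layerSubgroup k) (v.adicCompletion ℚ))))).restrict (subgroupIncl S)).toTopRep.ρ.invariants = 2 := by
      refine (Nat.card_congr ?_).trans hμcard
      exact { toFun := fun w ↦ w.1
              invFun := fun m ↦ ⟨m, fun σ ↦ htriv _ m⟩
              left_inv := fun _ ↦ rfl
              right_inv := fun _ ↦ rfl }
    have hH2S : Nat.card (continuousCohomology 2 ((((mu (v.adicCompletion ℚ) 2).restrict (subgroupIncl (localSubgroup (κ.layerSubgroup k) (v.adicCompletion ℚ))))).restrict (subgroupIncl S)).toTopRep) = 2 := by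
      rw [htr2]; exact hH2 (k + 1)
    rw [hinvS, hH2S, hcard1, hinv k, hH2 k] at hstep
    rw [← htr1]
    -- `2 * 2 * (2^(2^k+2))^2 = h * 16`
    have h16 : (2 : ℕ) * 2 * (2 ^ (2 ^ k + 2)) ^ 2 = 2 ^ (2 ^ (k + 1) + 2) * (2 * 2) ^ 2 := by
      rw [← pow_mul, pow_succ 2 k]; ring
    rw [h16] at hstep
    exact (mul_right_cancel₀ (by norm_num) hstep).symm


/-- **`#Hom_cont(H_n, ℤ/2) ≤ 2^{2^n+2}`** (finitely many) for the local layer subgroup `H_n` of the cyclotomic `ℤ₂`-tower at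
`v ∣ 2`: a continuous homomorphism `H_n → ℤ/2 ≅ μ₂` IS a continuous `1`-cocycle of the trivial module `μ₂`, and distinct ones
have distinct classes (no non-zero coboundaries); then `natCard_cohomology_mu_two_layer`. This is the right-hand side of
BRICK G3's Kummer count at `p = 2`. [cite: SerreGaloisCohomology1997, II §5.7 Thm. 5] -/
theorem natCard_contHom_zmod_two_layer_le (hκ : κ.IsCyclotomic) (v : HeightOneSpectrum (𝓞 ℚ))
    (hv : ((2 : ℕ) : 𝓞 ℚ) ∈ v.asIdeal) (n : ℕ) :
    Finite {f : localSubgroup (κ.layerSubgroup n) (v.adicCompletion ℚ) → ZMod 2 //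
        Continuous f ∧ ∀ a b, f (a * b) = f a + f b} ∧
      Nat.card {f : localSubgroup (κ.layerSubgroup n) (v.adicCompletion ℚ) → ZMod 2 //
        Continuous f ∧ ∀ a b, f (a * b) = f a + f b} ≤ 2 ^ (2 ^ n + 2) := by
  let Hn : Subgroup (absoluteGaloisGroup (v.adicCompletion ℚ)) := localSubgroup (κ.layerSubgroup n) (v.adicCompletion ℚ)
  let X : TopRep ℤ Hn := ((mu (v.adicCompletion ℚ) 2).restrict (subgroupIncl Hn)).toTopRep
  -- (`CharZero` only inside this block: a local `CharZero` instance would switch `Algebra ℚ ℚ_v` to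
  -- `DivisionRing.toRatAlgebra` in later elaborations)
  have hζ : IsPrimitiveRoot (-1 : (v.adicCompletion ℚ)) 2 := by
    haveI : CharZero (v.adicCompletion ℚ) :=
      charZero_of_injective_algebraMap (algebraMap ℚ (v.adicCompletion ℚ)).injective
    exact IsPrimitiveRoot.neg_one 0 (by norm_num)
  have htriv : ∀ (σ : absoluteGaloisGroup (v.adicCompletion ℚ)) (z : MuCarrier (v.adicCompletion ℚ) 2), mu (v.adicCompletion ℚ) 2 σ z = z :=
    mu_apply_eq_self_of_isPrimitiveRoot (v.adicCompletion ℚ) hζ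
  obtain ⟨ι, hι⟩ := exists_addMonoidHom_zmod_mu_injective (v.adicCompletion ℚ) hζ
  obtain ⟨hfin, -, hcard, -⟩ := natCard_cohomology_mu_two_layer hκ v hv n
  haveI := hfin
  -- the cocycle of a continuous homomorphism
  let c : {f : Hn → ZMod 2 // Continuous f ∧ ∀ a b, f (a * b) = f a + f b} → contOneCocycles X := fun f ↦
    ⟨⟨ι ∘ f.1, continuous_of_discreteTopology.comp f.2.1⟩, fun a b ↦ by
      change ι (f.1 (a * b)) = ι (f.1 a) + mu (v.adicCompletion ℚ) 2 (a : absoluteGaloisGroup (v.adicCompletion ℚ)) (ι (f.1 b))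
      rw [f.2.2, map_add, htriv]⟩
  have hc : ∀ f a, (c f).1 a = ι (f.1 a) := fun _ _ ↦ rfl
  have hinj : Function.Injective (fun f ↦ oneCocycleClass X (c f)) := by
    intro f g h
    have h0 : oneCocycleClass X (c f - c g) = 0 := by
      rw [oneCocycleClass_sub]; exact sub_eq_zero.mpr h
    obtain ⟨z, hz⟩ := (oneCocycleClass_eq_zero_iff _ _).mp h0
    refine Subtype.ext (funext fun a ↦ hι ?_)
    have h1 := hz a
    change (c f).1 a - (c g).1 a = mu (v.adicCompletion ℚ) 2 (a : absoluteGaloisGroup (v.adicCompletion ℚ)) z - z at h1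
    rw [htriv, sub_self, sub_eq_zero, hc, hc] at h1
    exact h1
  exact ⟨Finite.of_injective _ hinj, (Nat.card_le_card_of_injective _ hinj).trans hcard.le⟩

end Summit.BirchSwinnertonDyer.BirchSwinnertonDyer.Theorems.GoodOrdTower

end
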